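import Summits.BirchSwinnertonDyer.BirchSwinnertonDyer.Theorems.PrintCf2RubinValueTwoKatzMeasureJZeroSeamModelLattice
import Summits.BirchSwinnertonDyer.BirchSwinnertonDyer.Theorems.PrintCf2RubinValueTwoEllipticUnitsLocalModelPrincipal
import Literature.NumberTheory.EllipticCurves.DeShalit1987.RayClassFieldPAdicReading
import Literature.NumberTheory.EllipticCurves.X049IntegralModelReadings
import Literature.NumberTheory.NumberFields.RayClassFieldLocalReadingField
import Literature.NumberTheory.NumberFields.RayClassFieldArtinSymbolSurjective
import Literature.NumberTheory.NumberFields.RayClassFieldAdicTowerArtinClassesDegreeOne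
import Literature.NumberTheory.NumberFields.RayClassFieldSplitPrimePowerDegree
import Literature.NumberTheory.NumberFields.RayClassFieldAdicCharacter
import Literature.NumberTheory.GaloisRepresentations.LocalUnramifiedLevelMaxUnramified
import Literature.NumberTheory.ComplexMultiplication.EllipticUnits.DivisionPointsIndex
import Literature.NumberTheory.ComplexMultiplication.EllipticUnits.RubinTheta
import Literature.NumberTheory.ComplexMultiplication.EllipticUnits.DeShalitDivisionPointsLattice
import Literature.NumberTheory.ComplexMultiplication.EllipticUnits.GrossencharacterFrobeniusInverse
import HarnessLib

/-!
# Data for the per-label values of the `j = 0` seam: model coordinates, the algebraic theta data of a label, the label ideal `𝔟′`, and an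
# enlarged reading field with its `α`-datum ([I2] file 3a-data; proofs only)

Cell `bsd-print-cf2`, width seat `bsd-line-cf2-p1-w8` g14 (piece [I2] of the SEAM); `--supports` the crux stmt-BirchSwinnertonDyer-20368
(helper, Theses-free).  THEOREMS ONLY; no `def`, no named fact, no `sorry`.  Four packaging lemmas consumed by `…SeamValuesOfLabel`:

* `algClosureEmb_modelCoords` — from `ι̂ x = ℘(z)`, `ι̂ y = ℘′(z)` (clause (vi) of II.1.5) the MODEL coordinates `X = x + ¼`, `Y = (y − X)/2`
  of `W = [1,−1,0,−2,−1]` read `℘ − b₂/12`, `(℘′ − a₁(℘ − b₂/12) − a₃)/2`;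
* `exists_thetaData_of_label` — for the presentation `Λ_L = Ω′·w₀(𝔪)` and a label `𝔞 = (a)` prime to `𝔪` (and to `v`): representatives `S` of
  `𝔞⁻¹L/L`, the model coordinates of `ξ(Ω′)`, `ξ(α₀Ω′)`, `ξ(c)` (`c ∈ S ∖ 0`) in `K(𝔣ψ·𝔪𝔞)` with their values, their `𝔓`-integrality and the
  unit statement `‖e(x(ξΩ′) − x(ξc))‖ = 1` (from three pointwise INTEGRALITY ORACLES — de Shalit II.4.9 (i), hypotheses), and the theta
  constant `K_𝔞 = a⁻¹²·(−343)^{N𝔞−1} ∈ K` with its value and `v`-integrality — the «algebraic theta data» block of `…SeamValuesReadingField`;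
* `exists_labelIdeal` — an ideal `𝔟′` prime to `𝔣ψ·𝔪𝔞·v` with `τ_K⁻¹|_{K(𝔣ψ𝔪𝔞v)} = (𝔟′, ·)` (`RayClassFieldArtinSymbolSurjective`), its restriction
  to `K(𝔣ψ𝔪𝔞)`, an inverse `δ′` of `ψ(𝔟′)` modulo `𝔪𝔞`, `ψ(𝔟′)Ω′, ψ(𝔟′v)Ω′ ∉ 𝔞⁻¹L`, and clause (vii) at `{𝔟′, v, 𝔟′v}`;
* `exists_readingField` — a finite Galois unramified `E* ⊇ E ⊔ E₀ ⊔ K_v(ζ_{2^f−1})` containing `e(K(𝔐))` together with the `α`-datum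
  `α* = α₀^f ≡ 1 (mod 𝔑)` (`RayClassFieldLocalReadingField`, `unramifiedLevel`, `dvd_deg_of_toAbsGalois_mem_fixingSubgroup_unramifiedLevel`).
No summit statement is proved; BSD is not proved by any of this.

## References
* [deShalit1987] E. de Shalit, *Iwasawa theory of elliptic curves with complex multiplication* (1987), II §1.5 (15), II §4.3 (p. 57),
  II §4.7 (16), II §4.9 (i)(ii) (p. 62–63).
* [SilvermanAEC2009] J. H. Silverman, *The Arithmetic of Elliptic Curves*, 2nd ed. (2009), III.1, VI.3.6 (b).
* [NeukirchANT1999] J. Neukirch, *Algebraic Number Theory* (1999), Ch. II §8, Ch. VI §7 (7.1).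
-/

-- the summit namespace `Summit.BirchSwinnertonDyer.BirchSwinnertonDyer` repeats the problem name by design (D-0017)
set_option linter.dupNamespace false
set_option autoImplicit false

noncomputable section

open scoped Classical
open scoped NumberField
open PowerSeries IsDedekindDomain IsDedekindDomain.HeightOneSpectrum NumberField ValuativeRel Field PeriodPair
open Literature.NumberTheory.NumberFields Literature.NumberTheory.EllipticCurves Literature.NumberTheory.EllipticCurves.DeShalit1987
  Literature.NumberTheory.ComplexMultiplication.EllipticUnits
open Literature.NumberTheory.GaloisRepresentations Literature.NumberTheory.GaloisRepresentations.IsNonarchimedeanLocalField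
  Literature.NumberTheory.GaloisRepresentations.LubinTate _root_.WeierstrassCurve
open Literature.NumberTheory.LFunctions.AbelianDensity (artinSymbol)
open Summit.BirchSwinnertonDyer.BirchSwinnertonDyer.Theorems.PrintCf2.EllipticUnitsLocal

namespace Summit.BirchSwinnertonDyer.BirchSwinnertonDyer.Theorems.PrintCf2.KatzMeasureJZeroSeam

attribute [local instance] ltNormUniformSpace ltNormIsUniformAddGroup rk1 nF nE fintypeResidueField

variable {K : Type} [Field K] [NumberField K]

/-! ## §1 Model coordinates from the Weierstrass readings of clause (vi) -/

omit [NumberField K] in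
/-- From `ι̂ x = ℘(z)`, `ι̂ y = ℘′(z)` in a subfield `F ⊆ K̄`: the MODEL coordinates `X = x + ¼`, `Y = (y − X)/2` of `[1,−1,0,−2,−1]` read
`℘(z) − b₂/12` and `(℘′(z) − a₁(℘(z) − b₂/12) − a₃)/2` (`b₂/12 = −¼`, `a₁ = 1`, `a₃ = 0`). [cite: SilvermanAEC2009, III.1, VI.3.6 (b)] -/
theorem algClosureEmb_modelCoords (ι : K →+* ℂ) (F : IntermediateField K (AlgebraicClosure K)) {L : PeriodPair} {z : ℂ} {x y : F}
    (hx : algClosureEmb ι (x : AlgebraicClosure K) = ℘[L] z) (hy : algClosureEmb ι (y : AlgebraicClosure K) = ℘'[L] z) :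
    algClosureEmb ι ((x + algebraMap K F (1 / 4 : K) : F) : AlgebraicClosure K) =
        ℘[L] z - (((⟨1, -1, 0, -2, -1⟩ : WeierstrassCurve ℤ)).baseChange ℂ).b₂ / 12 ∧
      algClosureEmb ι (((y - (x + algebraMap K F (1 / 4 : K))) / 2 : F) : AlgebraicClosure K) =
        (℘'[L] z - (((⟨1, -1, 0, -2, -1⟩ : WeierstrassCurve ℤ)).baseChange ℂ).a₁ *
          (℘[L] z - (((⟨1, -1, 0, -2, -1⟩ : WeierstrassCurve ℤ)).baseChange ℂ).b₂ / 12) - (((⟨1, -1, 0, -2, -1⟩ : WeierstrassCurve ℤ)).baseChange ℂ).a₃) / 2 := by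
  have hbc : ((⟨1, -1, 0, -2, -1⟩ : WeierstrassCurve ℤ).baseChange ℂ) = (⟨1, -1, 0, -2, -1⟩ : WeierstrassCurve ℂ) := cm7Model_map _
  rw [hbc, cm7Model_b₂_div_twelve]
  have h4 : algClosureEmb ι ((algebraMap K F (1 / 4 : K) : F) : AlgebraicClosure K) = 1 / 4 := by
    rw [show ((algebraMap K F (1 / 4 : K) : F) : AlgebraicClosure K) = algebraMap K (AlgebraicClosure K) (1 / 4 : K) from rfl,
      algClosureEmb_algebraMap, map_div₀, map_one, map_ofNat]
  have hX : algClosureEmb ι ((x + algebraMap K F (1 / 4 : K) : F) : AlgebraicClosure K) = ℘[L] z - (-1 / 4) := by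
    rw [show ((x + algebraMap K F (1 / 4 : K) : F) : AlgebraicClosure K) = (x : AlgebraicClosure K) + ((algebraMap K F (1 / 4 : K) : F) :
      AlgebraicClosure K) from rfl, map_add, hx, h4]; ring
  refine ⟨hX, ?_⟩
  rw [show (((y - (x + algebraMap K F (1 / 4 : K))) / 2 : F) : AlgebraicClosure K) =
      ((y : AlgebraicClosure K) - ((x + algebraMap K F (1 / 4 : K) : F) : AlgebraicClosure K)) / 2 from by push_cast; rfl,
    map_div₀, map_sub, hy, hX, map_ofNat]
  change _ = (℘'[L] z - 1 * (℘[L] z - -1 / 4) - 0) / 2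
  ring

/-! ## §2 The algebraic theta data of a label -/

/-- ★ **The algebraic theta data of a label `𝔞 = (a)` at the presentation `Λ_L = Ω′·w₀(𝔪)`** (see the module docstring): representatives
`S` of `𝔞⁻¹L/L`, model coordinates of `ξ(Ω′)`, `ξ(α₀Ω′)`, `ξ(c)` at `K(𝔣ψ𝔪𝔞)` with values, `𝔓`-integrality (from the oracles) and the unit
statement, and the theta constant `a⁻¹²(−343)^{N𝔞−1}`. [cite: deShalit1987, II §1.5 (15), II §4.9 (i)(ii) (p. 62–63)]
[cite: SilvermanAEC2009, III.1, VI.3.6 (b)] -/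
theorem exists_thetaData_of_label {v : HeightOneSpectrum (𝓞 K)} (w₀ : InfinitePlace K)
    -- the presentation `Λ_L = Ω′·w₀(𝔪)` of the model lattice (`g₂ = 35/4`, `g₃ = 49/8`), `α₀ ∉ 𝔪`, `𝔪 ≠ 1`
    (L : PeriodPair) {𝔪 : Ideal (𝓞 K)} {Ω' : ℂ} (hL' : ∀ z : ℂ, z ∈ L.lattice ↔ ∃ t ∈ 𝔪, z = Ω' * w₀.embedding (t : K)) (hΩ' : Ω' ≠ 0)
    (h𝔪0 : 𝔪 ≠ ⊥) (h𝔪1 : 𝔪 ≠ ⊤) (h₂ : L.g₂ = (((⟨1, -1, 0, -2, -1⟩ : WeierstrassCurve ℤ)).baseChange ℂ).c₄ / 12)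
    (h₃ : L.g₃ = (((⟨1, -1, 0, -2, -1⟩ : WeierstrassCurve ℤ)).baseChange ℂ).c₆ / 216) {α₀ : 𝓞 K} (hα𝔪 : α₀ ∉ 𝔪)
    -- the label `𝔞 = (a)` prime to `𝔪` with `v ∤ 𝔪𝔞`, `a` read as a local unit, `L′ = 𝔞⁻¹L`
    {𝔞 : Ideal (𝓞 K)} {a : 𝓞 K} (ha0 : a ≠ 0) (h𝔞a : 𝔞 = Ideal.span {a}) (h𝔞𝔪 : IsCoprime 𝔞 𝔪) (hv𝔠r : ¬ 𝔪 * 𝔞 ≤ v.asIdeal)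
    (ca : 𝒪[v.adicCompletion K]ˣ) (hca : ((ca : 𝒪[v.adicCompletion K]) : v.adicCompletion K) = algebraMap K (v.adicCompletion K) (a : K))
    (La : PeriodPair) (hLa : La.lattice = idealInvLattice w₀.embedding 𝔞 L.lattice) (hK : IsImaginaryQuadratic K)
    -- clause (vi) of II.1.5 and the reading field `E ⊇ e(K(𝔣ψ𝔪𝔞))`
    {𝔣ψ : Ideal (𝓞 K)}
    (h6 : ∀ 𝔠 : Ideal (𝓞 K), 𝔠 ≠ ⊥ → ∀ z : ℂ, z ∈ idealInvLattice w₀.embedding 𝔠 L.lattice → z ∉ L.lattice →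
      ∃ x y : rayClassField K (𝔣ψ * 𝔠), algClosureEmb w₀.embedding x = ℘[L] z ∧ algClosureEmb w₀.embedding y = ℘'[L] z)
    (E : IntermediateField (v.adicCompletion K) (AlgebraicClosure (v.adicCompletion K))) [FiniteDimensional (v.adicCompletion K) E]
    (hEr : ∀ y : AlgebraicClosure K, y ∈ rayClassField K (𝔣ψ * (𝔪 * 𝔞)) → absClosureEmbedding K (v.adicCompletion K) y ∈ E)
    -- the three `𝔓`-integrality oracles (de Shalit II.4.9 (i), pointwise; hypotheses)
    (hIx : ∀ (𝔠 : Ideal (𝓞 K)), 𝔠 ≠ ⊥ → ¬ 𝔠 ≤ v.asIdeal → ∀ z : ℂ, z ∈ idealInvLattice w₀.embedding 𝔠 L.lattice → z ∉ L.lattice →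
      ∀ {𝔐 : Ideal (𝓞 K)} (F : IntermediateField (v.adicCompletion K) (AlgebraicClosure (v.adicCompletion K)))
        [FiniteDimensional (v.adicCompletion K) F]
        (hF : ∀ y : AlgebraicClosure K, y ∈ rayClassField K 𝔐 → absClosureEmbedding K (v.adicCompletion K) y ∈ F) (X : rayClassField K 𝔐),
        algClosureEmb w₀.embedding X = ℘[L] z - (((⟨1, -1, 0, -2, -1⟩ : WeierstrassCurve ℤ)).baseChange ℂ).b₂ / 12 → X ∈ readingRing F hF)
    (hIy : ∀ (𝔠 : Ideal (𝓞 K)), 𝔠 ≠ ⊥ → ¬ 𝔠 ≤ v.asIdeal → ∀ z : ℂ, z ∈ idealInvLattice w₀.embedding 𝔠 L.lattice → z ∉ L.lattice →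
      ∀ {𝔐 : Ideal (𝓞 K)} (F : IntermediateField (v.adicCompletion K) (AlgebraicClosure (v.adicCompletion K)))
        [FiniteDimensional (v.adicCompletion K) F]
        (hF : ∀ y : AlgebraicClosure K, y ∈ rayClassField K 𝔐 → absClosureEmbedding K (v.adicCompletion K) y ∈ F) (Y : rayClassField K 𝔐),
        algClosureEmb w₀.embedding Y = (℘'[L] z - (((⟨1, -1, 0, -2, -1⟩ : WeierstrassCurve ℤ)).baseChange ℂ).a₁ *
          (℘[L] z - (((⟨1, -1, 0, -2, -1⟩ : WeierstrassCurve ℤ)).baseChange ℂ).b₂ / 12) - (((⟨1, -1, 0, -2, -1⟩ : WeierstrassCurve ℤ)).baseChange ℂ).a₃) / 2 →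
        Y ∈ readingRing F hF)
    (hIu : ∀ (𝔠 : Ideal (𝓞 K)), 𝔠 ≠ ⊥ → ¬ 𝔠 ≤ v.asIdeal → ∀ z₁ z₂ : ℂ, z₁ ∈ idealInvLattice w₀.embedding 𝔠 L.lattice →
      z₂ ∈ idealInvLattice w₀.embedding 𝔠 L.lattice → z₁ ∉ L.lattice → z₂ ∉ L.lattice → z₁ - z₂ ∉ L.lattice → z₁ + z₂ ∉ L.lattice →
      ∀ {𝔐 : Ideal (𝓞 K)} (F : IntermediateField (v.adicCompletion K) (AlgebraicClosure (v.adicCompletion K)))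
        [FiniteDimensional (v.adicCompletion K) F]
        (hF : ∀ y : AlgebraicClosure K, y ∈ rayClassField K 𝔐 → absClosureEmbedding K (v.adicCompletion K) y ∈ F) (X₁ X₂ : rayClassField K 𝔐),
        algClosureEmb w₀.embedding X₁ = ℘[L] z₁ - (((⟨1, -1, 0, -2, -1⟩ : WeierstrassCurve ℤ)).baseChange ℂ).b₂ / 12 →
        algClosureEmb w₀.embedding X₂ = ℘[L] z₂ - (((⟨1, -1, 0, -2, -1⟩ : WeierstrassCurve ℤ)).baseChange ℂ).b₂ / 12 →
        ‖(readingFieldHom F hF (X₁ - X₂) : F)‖ = 1) :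
    ∃ (X₀ Y₀ X₁ Y₁ : rayClassField K (𝔣ψ * (𝔪 * 𝔞))) (S : Finset ℂ) (Xc : ℂ → rayClassField K (𝔣ψ * (𝔪 * 𝔞))),
      L.IsLatticeReps La S ∧
      algClosureEmb w₀.embedding X₀ = ℘[L] Ω' - (((⟨1, -1, 0, -2, -1⟩ : WeierstrassCurve ℤ)).baseChange ℂ).b₂ / 12 ∧
      algClosureEmb w₀.embedding Y₀ = (℘'[L] Ω' - (((⟨1, -1, 0, -2, -1⟩ : WeierstrassCurve ℤ)).baseChange ℂ).a₁ *
        (℘[L] Ω' - (((⟨1, -1, 0, -2, -1⟩ : WeierstrassCurve ℤ)).baseChange ℂ).b₂ / 12) - (((⟨1, -1, 0, -2, -1⟩ : WeierstrassCurve ℤ)).baseChange ℂ).a₃) / 2 ∧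
      algClosureEmb w₀.embedding X₁ = ℘[L] (w₀.embedding (α₀ : K) * Ω') - (((⟨1, -1, 0, -2, -1⟩ : WeierstrassCurve ℤ)).baseChange ℂ).b₂ / 12 ∧
      algClosureEmb w₀.embedding Y₁ = (℘'[L] (w₀.embedding (α₀ : K) * Ω') - (((⟨1, -1, 0, -2, -1⟩ : WeierstrassCurve ℤ)).baseChange ℂ).a₁ *
        (℘[L] (w₀.embedding (α₀ : K) * Ω') - (((⟨1, -1, 0, -2, -1⟩ : WeierstrassCurve ℤ)).baseChange ℂ).b₂ / 12) -
          (((⟨1, -1, 0, -2, -1⟩ : WeierstrassCurve ℤ)).baseChange ℂ).a₃) / 2 ∧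
      X₀ ∈ readingRing E hEr ∧ Y₀ ∈ readingRing E hEr ∧ X₁ ∈ readingRing E hEr ∧ Y₁ ∈ readingRing E hEr ∧
      w₀.embedding ((((a : K) ^ 12)⁻¹ * (-343) ^ (S.card - 1) : K)) = L.deltaRatio La * (L.g₂ ^ 3 - 27 * L.g₃ ^ 2) ^ (S.card - 1) ∧
      algebraMap K (v.adicCompletion K) ((((a : K) ^ 12)⁻¹ * (-343) ^ (S.card - 1) : K)) ∈ 𝒪[v.adicCompletion K] ∧
      (∀ c' ∈ S.erase 0, algClosureEmb w₀.embedding (Xc c') = ℘[L] c' - (((⟨1, -1, 0, -2, -1⟩ : WeierstrassCurve ℤ)).baseChange ℂ).b₂ / 12) ∧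
      (∀ c', Xc c' ∈ readingRing E hEr) ∧
      (∀ c' ∈ S.erase 0, ‖(readingFieldHom E hEr (X₀ - Xc c') : E)‖ = 1) ∧
      S.card = Ideal.absNorm 𝔞 := by
  -- ### lattice bookkeeping
  have hΛ : IsCMLattice w₀.embedding L.lattice := isCMLattice_of_model w₀.embedding hL'
  have hΩ'L : Ω' ∉ L.lattice := notMem_lattice_of_model w₀.embedding hL' hΩ' h𝔪1
  have h𝔞0 : 𝔞 ≠ ⊥ := by rw [h𝔞a]; simpa [Ideal.span_singleton_eq_bot] using ha0
  have h𝔠r0 : 𝔪 * 𝔞 ≠ ⊥ := mul_ne_zero h𝔪0 h𝔞0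
  have h𝔠r𝔪 : 𝔪 * 𝔞 ≤ 𝔪 := Ideal.mul_le_right
  have h𝔠r𝔞 : 𝔪 * 𝔞 ≤ 𝔞 := Ideal.mul_le_left
  have hΩ'𝔠 : Ω' ∈ idealInvLattice w₀.embedding (𝔪 * 𝔞) L.lattice :=
    mem_idealInvLattice_iff.mpr fun t ht ↦ mem_idealInvLattice_iff.mp (mem_idealInvLattice_of_model w₀.embedding hL') t (h𝔠r𝔪 ht)
  have hπΩ'𝔠 : w₀.embedding (α₀ : K) * Ω' ∈ idealInvLattice w₀.embedding (𝔪 * 𝔞) L.lattice := mul_mem_idealInvLattice w₀.embedding hΛ α₀ hΩ'𝔠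
  have hπΩ'L : w₀.embedding (α₀ : K) * Ω' ∉ L.lattice := mul_gen_notMem w₀.embedding hL' hΩ' hα𝔪
  -- ### the base points `ξ(Ω′)`, `ξ(α₀Ω′)`
  obtain ⟨x0, y0, hx0, hy0⟩ := h6 (𝔪 * 𝔞) h𝔠r0 Ω' hΩ'𝔠 hΩ'L
  obtain ⟨x1, y1, hx1, hy1⟩ := h6 (𝔪 * 𝔞) h𝔠r0 _ hπΩ'𝔠 hπΩ'L
  obtain ⟨hX₀, hY₀⟩ := algClosureEmb_modelCoords w₀.embedding (rayClassField K (𝔣ψ * (𝔪 * 𝔞))) hx0 hy0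
  obtain ⟨hX₁, hY₁⟩ := algClosureEmb_modelCoords w₀.embedding (rayClassField K (𝔣ψ * (𝔪 * 𝔞))) hx1 hy1
  -- ### representatives of `𝔞⁻¹L/L` and the readings of `ξ(c)`, `c ∈ S ∖ 0`
  obtain ⟨S, hS⟩ := PeriodPair.IsLatticeReps.exists (L := L) (L' := La) (hLa ▸ le_idealInvLattice hΛ 𝔞)
  have hrep : ∀ c' ∈ S.erase 0, c' ∈ idealInvLattice w₀.embedding (𝔪 * 𝔞) L.lattice ∧ c' ∉ L.lattice := fun c' hc' ↦ by
    obtain ⟨hc0, hcS⟩ := Finset.mem_erase.mp hc'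
    have h1 : c' ∈ La.lattice := hS.mem hcS
    rw [hLa] at h1
    exact ⟨mem_idealInvLattice_iff.mpr fun t ht ↦ mem_idealInvLattice_iff.mp h1 t (h𝔠r𝔞 ht),
      fun h ↦ hc0 (hS.distinct c' hcS 0 hS.zero_mem (by rwa [sub_zero]))⟩
  have hXc : ∀ c' : ℂ, ∃ X : rayClassField K (𝔣ψ * (𝔪 * 𝔞)), X ∈ readingRing E hEr ∧
      (c' ∈ S.erase 0 → algClosureEmb w₀.embedding X = ℘[L] c' - (((⟨1, -1, 0, -2, -1⟩ : WeierstrassCurve ℤ)).baseChange ℂ).b₂ / 12) := by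
    intro c'
    by_cases hc' : c' ∈ S.erase 0
    · obtain ⟨hc1, hc2⟩ := hrep c' hc'
      obtain ⟨xc, yc, hxc, hyc⟩ := h6 (𝔪 * 𝔞) h𝔠r0 c' hc1 hc2
      obtain ⟨hXc', -⟩ := algClosureEmb_modelCoords w₀.embedding (rayClassField K (𝔣ψ * (𝔪 * 𝔞))) hxc hyc
      exact ⟨_, hIx (𝔪 * 𝔞) h𝔠r0 hv𝔠r c' hc1 hc2 E hEr _ hXc', fun _ ↦ hXc'⟩
    · exact ⟨0, Subring.zero_mem _, fun h ↦ (hc' h).elim⟩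
  choose Xc hXci hXc using hXc
  -- `Ω′ ± c ∉ L` (else `Ω′ ∈ 𝔞⁻¹L`, i.e. `𝔞 ⊆ 𝔪`, against `(𝔞, 𝔪) = 1`, `𝔪 ≠ 1`)
  have hΩ'pm : ∀ c' ∈ S.erase 0, Ω' - c' ∉ L.lattice ∧ Ω' + c' ∉ L.lattice := by
    intro c' hc'
    have hcLa : c' ∈ La.lattice := hS.mem (Finset.mem_erase.mp hc').2
    have key : Ω' ∉ La.lattice := by
      intro h
      rw [hLa] at h
      have h𝔞le : 𝔞 ≤ 𝔪 := fun t ht ↦ by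
        have h1 := mem_idealInvLattice_iff.mp h t ht
        rw [mul_comm] at h1
        exact (mul_mem_lattice_iff_of_model w₀.embedding hL' hΩ' t).mp h1
      have htop := Ideal.isCoprime_iff_sup_eq.mp h𝔞𝔪
      rw [sup_eq_right.mpr h𝔞le] at htop
      exact h𝔪1 htop
    refine ⟨fun h ↦ key ?_, fun h ↦ key ?_⟩
    · have e1 : Ω' = (Ω' - c') + c' := by ring
      rw [e1]; exact La.lattice.add_mem (hS.le h) hcLa
    · have e1 : Ω' = (Ω' + c') - c' := by ring
      rw [e1]; exact La.lattice.sub_mem (hS.le h) hcLa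
  -- ### the theta constant
  have hLa' : La.lattice = idealInvLattice w₀.embedding (Ideal.span {a}) L.lattice := by rw [hLa, h𝔞a]
  have hwa : w₀.embedding (a : K) ≠ 0 := (map_ne_zero _).mpr (by exact_mod_cast ha0)
  have hbc : ((⟨1, -1, 0, -2, -1⟩ : WeierstrassCurve ℤ).baseChange ℂ) = (⟨1, -1, 0, -2, -1⟩ : WeierstrassCurve ℂ) := cm7Model_map _
  have hΔL : L.g₂ ^ 3 - 27 * L.g₃ ^ 2 = -343 := by
    rw [h₂, h₃, hbc, cm7Model_c₄_div_twelve, cm7Model_c₆_div, cm7Model_g₂_pow_three_sub]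
  have hKcK : w₀.embedding ((((a : K) ^ 12)⁻¹ * (-343) ^ (S.card - 1) : K)) = L.deltaRatio La * (L.g₂ ^ 3 - 27 * L.g₃ ^ 2) ^ (S.card - 1) := by
    rw [deltaRatio_eq_of_span_singleton hΛ hwa hLa', hΔL, map_mul, map_inv₀, map_pow, map_pow, map_neg, map_ofNat]
  have hKci : algebraMap K (v.adicCompletion K) ((((a : K) ^ 12)⁻¹ * (-343) ^ (S.card - 1) : K)) ∈ 𝒪[v.adicCompletion K] := by
    have hinvK : ((((ca⁻¹ : 𝒪[v.adicCompletion K]ˣ) : 𝒪[v.adicCompletion K]) : v.adicCompletion K)) =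
        (((ca : 𝒪[v.adicCompletion K]) : v.adicCompletion K))⁻¹ := by
      refine eq_inv_of_mul_eq_one_left ?_
      have h1 := congrArg (Subtype.val) ca.inv_mul
      push_cast at h1
      exact h1
    have e1 : algebraMap K (v.adicCompletion K) ((((a : K) ^ 12)⁻¹ * (-343) ^ (S.card - 1) : K)) =
        ((((ca⁻¹ : 𝒪[v.adicCompletion K]ˣ) : 𝒪[v.adicCompletion K]) : v.adicCompletion K)) ^ 12 * (-343) ^ (S.card - 1) := by
      rw [map_mul, map_pow, map_neg, map_ofNat, map_inv₀, map_pow, ← hca, hinvK, inv_pow]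
    rw [e1]
    exact mul_mem (pow_mem (ca⁻¹ : 𝒪[v.adicCompletion K]ˣ).val.2 _) (pow_mem (neg_mem (ofNat_mem _ 343)) _)
  refine ⟨_, _, _, _, S, Xc, hS, hX₀, hY₀, hX₁, hY₁, hIx (𝔪 * 𝔞) h𝔠r0 hv𝔠r Ω' hΩ'𝔠 hΩ'L E hEr _ hX₀,
    hIy (𝔪 * 𝔞) h𝔠r0 hv𝔠r Ω' hΩ'𝔠 hΩ'L E hEr _ hY₀, hIx (𝔪 * 𝔞) h𝔠r0 hv𝔠r _ hπΩ'𝔠 hπΩ'L E hEr _ hX₁,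
    hIy (𝔪 * 𝔞) h𝔠r0 hv𝔠r _ hπΩ'𝔠 hπΩ'L E hEr _ hY₁, hKcK, hKci, hXc, hXci, fun c' hc' ↦ ?_, hS.card_eq_absNorm hK w₀.embedding hΛ h𝔞0 hLa⟩
  exact hIu (𝔪 * 𝔞) h𝔠r0 hv𝔠r Ω' c' hΩ'𝔠 (hrep c' hc').1 hΩ'L (hrep c' hc').2 (hΩ'pm c' hc').1 (hΩ'pm c' hc').2 E hEr _ _ hX₀ (hXc c' hc')

/-! ## §3 The label ideal `𝔟′` -/

/-- ★ **The label ideal `𝔟′`**: for `τ_K ∈ Γ_K` there is an integral ideal `𝔟′` prime to `𝔣ψ·𝔪𝔞·v` with `τ_K⁻¹|_{K(𝔣ψ𝔪𝔞v)} = (𝔟′, ·)`, hence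
also on `K(𝔣ψ𝔪𝔞)`; `ψ(𝔟′)` is invertible modulo `𝔪𝔞`; `ψ(𝔟′)Ω′, ψ(𝔟′v)Ω′ ∉ 𝔞⁻¹L` for `Λ_L = Ω′·w₀(𝔪)` (`𝔞, 𝔟′, v` prime to `𝔪 ≠ 1`); and clause
(vii) of II.1.5 holds at `𝔟′`, `v`, `𝔟′v` on `K(𝔣ψ𝔪𝔞)`. [cite: deShalit1987, II §1.5 (15), II §4.7 (16) (p. 60)] [cite: NeukirchANT1999, Ch. VI §7 (7.1)] -/
theorem exists_labelIdeal [IsTotallyComplex K] {v : HeightOneSpectrum (𝓞 K)} (w₀ : InfinitePlace K) (τK : absoluteGaloisGroup K)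
    (L : PeriodPair) {𝔪 : Ideal (𝓞 K)} {Ω' : ℂ} (hL' : ∀ z : ℂ, z ∈ L.lattice ↔ ∃ t ∈ 𝔪, z = Ω' * w₀.embedding (t : K)) (hΩ' : Ω' ≠ 0)
    (h𝔪0 : 𝔪 ≠ ⊥) (h𝔪1 : 𝔪 ≠ ⊤) (hv𝔪 : ¬ 𝔪 ≤ v.asIdeal) {α₀ : 𝓞 K} (hv0 : v.asIdeal = Ideal.span {α₀})
    {𝔞 : Ideal (𝓞 K)} (h𝔞0 : 𝔞 ≠ ⊥) (h𝔞𝔪 : IsCoprime 𝔞 𝔪) (hv𝔞 : ¬ 𝔞 ≤ v.asIdeal)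
    (La : PeriodPair) (hLa : La.lattice = idealInvLattice w₀.embedding 𝔞 L.lattice)
    (ψK : Ideal (𝓞 K) → 𝓞 K) {𝔣ψ : Ideal (𝓞 K)} (h𝔣ψ0 : 𝔣ψ ≠ ⊥) (hv𝔣ψ : ¬ 𝔣ψ ≤ v.asIdeal)
    (hψmul : ∀ 𝔞 𝔟 : Ideal (𝓞 K), IsCoprime 𝔞 𝔣ψ → IsCoprime 𝔟 𝔣ψ → ψK (𝔞 * 𝔟) = ψK 𝔞 * ψK 𝔟)
    (hψspan : ∀ 𝔞 : Ideal (𝓞 K), IsCoprime 𝔞 𝔣ψ → Ideal.span {ψK 𝔞} = 𝔞) (hψv : ψK v.asIdeal = α₀)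
    (h7 : ∀ 𝔠 : Ideal (𝓞 K), 𝔠 ≠ ⊥ → ∀ z : ℂ, z ∈ idealInvLattice w₀.embedding 𝔠 L.lattice → z ∉ L.lattice →
      ∀ 𝔟 : Ideal (𝓞 K), IsCoprime 𝔟 (𝔣ψ * 𝔠) → ∀ x y : rayClassField K (𝔣ψ * 𝔠),
        algClosureEmb w₀.embedding x = ℘[L] z → algClosureEmb w₀.embedding y = ℘'[L] z →
          algClosureEmb w₀.embedding (artinSymbol (galFrob K (rayClassField K (𝔣ψ * 𝔠))) 𝔟 x) = ℘[L] (w₀.embedding (ψK 𝔟 : K) * z) ∧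
          algClosureEmb w₀.embedding (artinSymbol (galFrob K (rayClassField K (𝔣ψ * 𝔠))) 𝔟 y) = ℘'[L] (w₀.embedding (ψK 𝔟 : K) * z)) :
    ∃ (𝔟' : Ideal (𝓞 K)) (δ' : 𝓞 K), 𝔟' ≠ ⊥ ∧ IsCoprime 𝔟' (𝔣ψ * (𝔪 * 𝔞) * v.asIdeal) ∧
      absRestrictNormalHom (rayClassField K (𝔣ψ * (𝔪 * 𝔞) * v.asIdeal)) τK⁻¹ =
        artinSymbol (galFrob K (rayClassField K (𝔣ψ * (𝔪 * 𝔞) * v.asIdeal))) 𝔟' ∧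
      absRestrictNormalHom (rayClassField K (𝔣ψ * (𝔪 * 𝔞))) τK⁻¹ = artinSymbol (galFrob K (rayClassField K (𝔣ψ * (𝔪 * 𝔞)))) 𝔟' ∧
      δ' * ψK 𝔟' - 1 ∈ 𝔪 * 𝔞 ∧ ψK (𝔟' * v.asIdeal) = ψK 𝔟' * α₀ ∧
      w₀.embedding (ψK 𝔟' : K) * Ω' ∉ La.lattice ∧ w₀.embedding (ψK (𝔟' * v.asIdeal) : K) * Ω' ∉ La.lattice ∧
      ∀ 𝔟'' ∈ ({𝔟', v.asIdeal, 𝔟' * v.asIdeal} : Set (Ideal (𝓞 K))), ∀ z : ℂ, z ∈ idealInvLattice w₀.embedding (𝔪 * 𝔞) L.lattice →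
        z ∉ L.lattice → ∀ x y : rayClassField K (𝔣ψ * (𝔪 * 𝔞)), algClosureEmb w₀.embedding x = ℘[L] z → algClosureEmb w₀.embedding y = ℘'[L] z →
          algClosureEmb w₀.embedding (artinSymbol (galFrob K (rayClassField K (𝔣ψ * (𝔪 * 𝔞)))) 𝔟'' x) = ℘[L] (w₀.embedding (ψK 𝔟'' : K) * z) ∧
          algClosureEmb w₀.embedding (artinSymbol (galFrob K (rayClassField K (𝔣ψ * (𝔪 * 𝔞)))) 𝔟'' y) = ℘'[L] (w₀.embedding (ψK 𝔟'' : K) * z) := by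
  -- `v` is coprime to every ideal it does not contain
  have hcopv : ∀ I : Ideal (𝓞 K), ¬ I ≤ v.asIdeal → IsCoprime v.asIdeal I := fun I hI ↦ by
    rw [Ideal.isCoprime_iff_sup_eq]
    by_contra hne
    exact hI ((v.isMaximal.eq_of_le hne le_sup_left).symm ▸ le_sup_right)
  have h𝔠r0 : 𝔪 * 𝔞 ≠ ⊥ := mul_ne_zero h𝔪0 h𝔞0
  have hv𝔠r : ¬ 𝔪 * 𝔞 ≤ v.asIdeal := fun h ↦ (v.isPrime.mul_le.mp h).elim hv𝔪 hv𝔞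
  have h𝔣𝔠0 : 𝔣ψ * (𝔪 * 𝔞) ≠ ⊥ := mul_ne_zero h𝔣ψ0 h𝔠r0
  have hv𝔣𝔠 : ¬ 𝔣ψ * (𝔪 * 𝔞) ≤ v.asIdeal := fun h ↦ (v.isPrime.mul_le.mp h).elim hv𝔣ψ hv𝔠r
  have h𝔣𝔠v0 : 𝔣ψ * (𝔪 * 𝔞) * v.asIdeal ≠ ⊥ := mul_ne_zero h𝔣𝔠0 v.ne_bot
  -- ### the choice of `𝔟′` and its restriction to `K(𝔣ψ𝔪𝔞)`
  obtain ⟨𝔟', h𝔟'0, h𝔟'cop, h𝔟'art⟩ := exists_ideal_artinSymbol_eq_absRestrictNormalHom h𝔣𝔠v0 τK⁻¹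
  have h𝔟'c : IsCoprime 𝔟' (𝔣ψ * (𝔪 * 𝔞)) := h𝔟'cop.of_mul_right_left
  have h𝔟'ψ : IsCoprime 𝔟' 𝔣ψ := h𝔟'c.of_mul_right_left
  have h𝔟'𝔠 : IsCoprime 𝔟' (𝔪 * 𝔞) := h𝔟'c.of_mul_right_right
  have hvψ : IsCoprime v.asIdeal 𝔣ψ := hcopv _ hv𝔣ψ
  obtain ⟨g', hg'⟩ := exists_forall_absRestrictNormalHom_eq_artinSymbol_of_isCoprime h𝔟'0
  have hg : absRestrictNormalHom (rayClassField K (𝔣ψ * (𝔪 * 𝔞))) τK⁻¹ =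
      artinSymbol (galFrob K (rayClassField K (𝔣ψ * (𝔪 * 𝔞)))) 𝔟' := by
    rw [← hg' _ h𝔣𝔠0 h𝔟'c]
    exact absRestrictNormalHom_eq_of_le (σ := τK⁻¹) (τ := g') (rayClassField_le_of_le h𝔣𝔠v0 Ideal.mul_le_right)
      (by rw [← h𝔟'art, hg' _ h𝔣𝔠v0 h𝔟'cop])
  -- ### an inverse of `ψ(𝔟′)` modulo `𝔪𝔞`
  have hψ𝔟' : Ideal.span {ψK 𝔟'} = 𝔟' := hψspan 𝔟' h𝔟'ψ
  obtain ⟨δ', hδ'⟩ : ∃ δ' : 𝓞 K, δ' * ψK 𝔟' - 1 ∈ 𝔪 * 𝔞 := by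
    have h1 : IsCoprime (Ideal.span {ψK 𝔟'}) (𝔪 * 𝔞) := by rw [hψ𝔟']; exact h𝔟'𝔠
    obtain ⟨i, hi, j, hj, hij⟩ := Ideal.isCoprime_iff_exists.mp h1
    obtain ⟨r, rfl⟩ := Ideal.mem_span_singleton'.mp hi
    exact ⟨r, by rw [show r * ψK 𝔟' - 1 = -j by linear_combination hij]; exact (𝔪 * 𝔞).neg_mem hj⟩
  have hψv𝔟' : ψK (𝔟' * v.asIdeal) = ψK 𝔟' * α₀ := by rw [hψmul 𝔟' v.asIdeal h𝔟'ψ hvψ, hψv]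
  -- ### `ψ(𝔟′)Ω′, ψ(𝔟′v)Ω′ ∉ 𝔞⁻¹L`
  have hΩb_aux : ∀ t : 𝓞 K, IsCoprime (Ideal.span {t}) 𝔪 → w₀.embedding (t : K) * Ω' ∉ La.lattice := by
    intro t ht h
    rw [hLa] at h
    have hle : 𝔞 * Ideal.span {t} ≤ 𝔪 := by
      rw [Ideal.mul_le]
      intro r hr s hs
      obtain ⟨s', rfl⟩ := Ideal.mem_span_singleton'.mp hs
      have h1 := mem_idealInvLattice_iff.mp h r hr
      have e1 : w₀.embedding (r : K) * (w₀.embedding (t : K) * Ω') = Ω' * w₀.embedding ((r * t : 𝓞 K) : K) := by push_cast; rw [map_mul]; ring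
      rw [e1, mul_mem_lattice_iff_of_model w₀.embedding hL' hΩ'] at h1
      rw [← mul_assoc, mul_comm r s', mul_assoc]
      exact 𝔪.mul_mem_left _ h1
    have hcop : IsCoprime (𝔞 * Ideal.span {t}) 𝔪 := h𝔞𝔪.mul_left ht
    have htop := Ideal.isCoprime_iff_sup_eq.mp hcop
    rw [sup_eq_right.mpr hle] at htop
    exact h𝔪1 htop
  have hΩb : w₀.embedding (ψK 𝔟' : K) * Ω' ∉ La.lattice := hΩb_aux _ (by rw [hψ𝔟']; exact h𝔟'𝔠.of_mul_right_left)
  have hΩb' : w₀.embedding (ψK (𝔟' * v.asIdeal) : K) * Ω' ∉ La.lattice := hΩb_aux _ (by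
    rw [hψv𝔟', ← Ideal.span_singleton_mul_span_singleton, hψ𝔟', ← hv0]
    exact (h𝔟'𝔠.of_mul_right_left).mul_left (hcopv _ hv𝔪))
  -- ### clause (vii) at the reading level for `𝔟′`, `v`, `𝔟′v`
  refine ⟨𝔟', δ', h𝔟'0, h𝔟'cop, h𝔟'art.symm, hg, hδ', hψv𝔟', hΩb, hΩb', fun 𝔟'' h𝔟'' z hz hzL x y hx hy ↦ ?_⟩
  simp only [Set.mem_insert_iff, Set.mem_singleton_iff] at h𝔟''
  have hc'' : IsCoprime 𝔟'' (𝔣ψ * (𝔪 * 𝔞)) := by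
    rcases h𝔟'' with rfl | rfl | rfl
    · exact h𝔟'c
    · exact hcopv _ hv𝔣𝔠
    · exact h𝔟'c.mul_left (hcopv _ hv𝔣𝔠)
  exact h7 (𝔪 * 𝔞) h𝔠r0 z hz hzL 𝔟'' hc'' x y hx hy

/-! ## §4 An enlarged reading field with its `α`-datum -/

/-- ★ **A finite Galois unramified reading field `E* ⊇ E ⊔ E₀ ⊔ K_v(ζ_{2^f−1})` containing `e(K(𝔐))`, with the `α`-datum `α* = α₀^f`**
(`α₀^f ≡ 1 (mod 𝔑)`, `f ∣ deg w` for every local Weil element fixing `E*`): the reading field of the per-label bridge, over which the level's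
coefficient field `E` and the reference field `E₀` are base-changed. [cite: deShalit1987, II §4.3 (p. 57), II §4.4 Definition]
[cite: NeukirchANT1999, Ch. II §8] -/
theorem exists_readingField {v : HeightOneSpectrum (𝓞 K)}
    (E E₀ : IntermediateField (v.adicCompletion K) (AlgebraicClosure (v.adicCompletion K)))
    [FiniteDimensional (v.adicCompletion K) E] [IsGalois (v.adicCompletion K) E]
    [FiniteDimensional (v.adicCompletion K) E₀] [IsGalois (v.adicCompletion K) E₀]
    (hE : E ≤ maxUnramified (v.adicCompletion K)) (hE₀ : E₀ ≤ maxUnramified (v.adicCompletion K))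
    {𝔐 𝔑 : Ideal (𝓞 K)} (h𝔐0 : 𝔐 ≠ ⊥) (hv𝔐 : ¬ 𝔐 ≤ v.asIdeal) (h𝔑0 : 𝔑 ≠ ⊥) (hv𝔑 : ¬ 𝔑 ≤ v.asIdeal)
    {α₀ : 𝓞 K} (hv0 : v.asIdeal = Ideal.span {α₀}) (u : 𝒪[v.adicCompletion K]ˣ)
    (hu : ((((u : 𝒪[v.adicCompletion K]) * ((2 : ℕ) : 𝒪[v.adicCompletion K]) : 𝒪[v.adicCompletion K]) : v.adicCompletion K)) =
      ((α₀ : K) : v.adicCompletion K)) :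
    ∃ Es : IntermediateField (v.adicCompletion K) (AlgebraicClosure (v.adicCompletion K)),
      FiniteDimensional (v.adicCompletion K) Es ∧ IsGalois (v.adicCompletion K) Es ∧ E ≤ Es ∧ E₀ ≤ Es ∧ Es ≤ maxUnramified (v.adicCompletion K) ∧
      (∀ y : AlgebraicClosure K, y ∈ rayClassField K 𝔐 → absClosureEmbedding K (v.adicCompletion K) y ∈ Es) ∧
      ∃ f : ℕ, (α₀ ^ f : 𝓞 K) ≠ 0 ∧ (α₀ ^ f : 𝓞 K) - 1 ∈ 𝔑 ∧ (∀ w : HeightOneSpectrum (𝓞 K), w ≠ v → (α₀ ^ f : 𝓞 K) ∉ w.asIdeal) ∧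
        (((α₀ ^ f : 𝓞 K) : K) : v.adicCompletion K) =
          ((((u : 𝒪[v.adicCompletion K]) * ((2 : ℕ) : 𝒪[v.adicCompletion K]) : 𝒪[v.adicCompletion K]) : v.adicCompletion K)) ^ f ∧
        ∀ w : WeilGroup (v.adicCompletion K), WeilGroup.toAbsGalois (v.adicCompletion K) w ∈ Es.fixingSubgroup → (f : ℤ) ∣ WeilGroup.deg w := by
  haveI : CharZero (v.adicCompletion K) := charZero_of_injective_algebraMap (algebraMap K (v.adicCompletion K)).injective
  -- the `α`-datum at `𝔑`
  obtain ⟨fs, hfs0, hfs⟩ := exists_pow_sub_one_mem_of_asIdeal_eq_span h𝔑0 hv𝔑 hv0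
  have hαsπ : (((α₀ ^ fs : 𝓞 K) : K) : v.adicCompletion K) =
      ((((u : 𝒪[v.adicCompletion K]) * ((2 : ℕ) : 𝒪[v.adicCompletion K]) : 𝒪[v.adicCompletion K]) : v.adicCompletion K)) ^ fs := by
    have h1 : ((α₀ ^ fs : 𝓞 K) : K) = ((α₀ : 𝓞 K) : K) ^ fs := by push_cast; rfl
    rw [h1, coe_pow_adicCompletion, hu]
  -- the unramified level `K_v(ζ_{2^{fs} − 1})`
  obtain ⟨hfdU, habU, -⟩ := LocalWeilDatum.unramifiedLevel_finite_abelian_unramified (v.adicCompletion K) hfs0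
  haveI := hfdU
  haveI := habU
  have hUu : LocalWeilDatum.unramifiedLevel (v.adicCompletion K) fs ≤ maxUnramified (v.adicCompletion K) :=
    unramifiedLevel_le_maxUnramified _ hfs0
  haveI : IsGalois (v.adicCompletion K) (E ⊔ E₀ : IntermediateField (v.adicCompletion K) (AlgebraicClosure (v.adicCompletion K))) :=
    isGalois_iff.2 ⟨inferInstance, inferInstance⟩
  haveI : IsGalois (v.adicCompletion K) ((E ⊔ E₀) ⊔ LocalWeilDatum.unramifiedLevel (v.adicCompletion K) fs :
      IntermediateField (v.adicCompletion K) (AlgebraicClosure (v.adicCompletion K))) :=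
    isGalois_iff.2 ⟨inferInstance, inferInstance⟩
  obtain ⟨Es, hfdEs, hgalEs, hleEs, hEsu, hEs⟩ := exists_finite_galois_le_maxUnramified_forall_mem h𝔐0 hv𝔐
    ((E ⊔ E₀) ⊔ LocalWeilDatum.unramifiedLevel (v.adicCompletion K) fs) (sup_le (sup_le hE hE₀) hUu)
  refine ⟨Es, hfdEs, hgalEs, (le_sup_left.trans le_sup_left).trans hleEs, (le_sup_right.trans le_sup_left).trans hleEs, hEsu, hEs, fs,
    pow_ne_zero _ (ne_zero_of_asIdeal_eq_span hv0), hfs, fun w hw ↦ pow_not_mem_of_ne hv0 w hw fs, hαsπ, fun w hw ↦ ?_⟩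
  exact dvd_deg_of_toAbsGalois_mem_fixingSubgroup_unramifiedLevel _ hfs0 w
    (IntermediateField.fixingSubgroup_le (le_sup_right.trans hleEs) hw)

end Summit.BirchSwinnertonDyer.BirchSwinnertonDyer.Theorems.PrintCf2.KatzMeasureJZeroSeam

end
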